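import Literature.MathematicalPhysics.QuantumManyBody.PeriodicFeynmanKacTrialState
import Literature.MathematicalPhysics.QuantumManyBody.PeriodicHeatFlowSpectral
import Literature.MathematicalPhysics.QuantumManyBody.WeightedCorrector
import HarnessLib

/-!
# Response dictionary, part B: the mollified Feynman–Kac ground state

Support file for the registered stub `stub_responseDictionary` of line `healing-scale-kac-insertion`
(crux `BECInsertionCorrector.CorrectorClosure`, item stmt-AtomisticToContinuum-12058). For a
continuous periodic `Θ₀` the mollified sequence `Θ_n = ρ_{1/(n+1)} ⋆ Θ₀` (`mollify` of
`GroundStateFeynmanKacTrialState`) converges uniformly, hence all weighted masses `∫_cell Θ_n² w`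
with bounded weights converge; if `Θ₀` is a torus Feynman–Kac ground state
(`IsPeriodicGroundStateFK`) then its real normalisation and the integrated eigen-relation in the
`pfkReal` form hold, and the kinetic integral of every mollification is at most
`E₀ - ∫_cell Θ₀² V^per` (Chung–Zhao's free-form bound, `setLIntegral_cellN_realKinetic_mollify_le`).
Supports (does not close) stmt-AtomisticToContinuum-12058, route `BECInsertionCorrector`.
-/

noncomputable section

open MeasureTheory Filter
open scoped ENNReal NNReal BigOperators Topology

namespace Summit.AtomisticToContinuum.BoseEinsteinCondensation.Theorems.CorrectorClosure.HealingScaleKacInsertion.ResponseDictionary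

open Literature.MathematicalPhysics.QuantumManyBody.BoseGas

variable {N : ℕ}


/-! ### The mollified sequence `ρ_{1/(n+1)} ⋆ Θ₀` -/

/-- **Uniform convergence of the mollified sequence**: for `s > 0`, eventually in `n`,
`sup |ρ_{1/(n+1)} ⋆ Θ₀ - Θ₀| ≤ s`. [folklore] -/
theorem eventually_abs_mollify_sub_le {L : ℝ} (hL : 0 < L) {Θ₀ : Config N → ℝ}
    (hcont : Continuous Θ₀)
    (hper : ∀ (X : Config N) (i : Fin N) (k : Fin 3),
      Θ₀ (X + Pi.single i (EuclideanSpace.single k L)) = Θ₀ X)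
    {s : ℝ} (hs : 0 < s) :
    ∀ᶠ n : ℕ in atTop, ∀ X, |mollify (Nat.one_div_pos_of_nat (n := n)) Θ₀ X - Θ₀ X| ≤ s := by
  obtain ⟨r₀, hr₀, h⟩ := abs_mollify_sub_le_of_periodic hL hcont hper hs
  have hev : ∀ᶠ n : ℕ in atTop, 1 / ((n : ℝ) + 1) ≤ r₀ :=
    (tendsto_one_div_add_atTop_nhds_zero_nat (𝕜 := ℝ)).eventually_le_const hr₀
  filter_upwards [hev] with n hn
  exact h _ Nat.one_div_pos_of_nat hn

/-! ### Convergence of weighted masses under uniform convergence -/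

/-- **Weighted masses converge under uniform convergence with uniform bounds**: if `F_n → Θ₀`
uniformly with `|F_n|, |Θ₀| ≤ M` and `|w| ≤ B`, then `∫_cell F_n² w → ∫_cell Θ₀² w`. [folklore] -/
theorem tendsto_integral_sq_mul {L : ℝ} {Θ₀ : Config N → ℝ} {F : ℕ → Config N → ℝ} {M : ℝ}
    (hM0 : ∀ X, |Θ₀ X| ≤ M) (hM : ∀ n X, |F n X| ≤ M)
    (hunif : ∀ s : ℝ, 0 < s → ∀ᶠ n : ℕ in atTop, ∀ X, |F n X - Θ₀ X| ≤ s)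
    {w : Config N → ℝ} {B : ℝ} (hw : ∀ X, |w X| ≤ B)
    (hi0 : IntegrableOn (fun X => Θ₀ X ^ 2 * w X) (cellN N L))
    (hin : ∀ n, IntegrableOn (fun X => F n X ^ 2 * w X) (cellN N L)) :
    Tendsto (fun n => ∫ X in cellN N L, F n X ^ 2 * w X) atTop
      (𝓝 (∫ X in cellN N L, Θ₀ X ^ 2 * w X)) := by
  have hB0 : 0 ≤ B := (abs_nonneg _).trans (hw 0)
  have hMnn : 0 ≤ M := (abs_nonneg _).trans (hM0 0)
  set K : ℝ := B * (volume (cellN N L)).toReal * (2 * M) with hK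
  have hK0 : 0 ≤ K := by positivity
  rw [Metric.tendsto_nhds]
  intro ε hε
  have hs : 0 < ε / (2 * (K + 1)) := by positivity
  filter_upwards [hunif _ hs] with n hn
  rw [Real.dist_eq]
  have h := abs_setIntegral_cellN_sq_sub_sq_mul_le (L := L) hs.le (hM n) hM0 hw hn
  have heq : ∫ X in cellN N L, (F n X ^ 2 - Θ₀ X ^ 2) * w X =
      (∫ X in cellN N L, F n X ^ 2 * w X) - ∫ X in cellN N L, Θ₀ X ^ 2 * w X := by
    rw [← integral_sub (hin n) hi0]
    exact integral_congr_ae (ae_of_all _ fun X => by ring)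
  rw [heq] at h
  calc |(∫ X in cellN N L, F n X ^ 2 * w X) - ∫ X in cellN N L, Θ₀ X ^ 2 * w X|
      ≤ K * (ε / (2 * (K + 1))) := h
    _ < ε := by
        rw [mul_div_assoc']
        rw [div_lt_iff₀ (by positivity)]
        nlinarith

/-! ### The real kinetic integral of a `C¹` function -/

/-- `∫⁻_cell |∇φ|² = ofReal (∫_cell Γ(φ,φ))` for `C¹` `φ`. [folklore] -/
theorem setLIntegral_realKinetic_eq_ofReal (L : ℝ) {φ : Config N → ℝ} (hφ : ContDiff ℝ 1 φ) :
    ∫⁻ X in cellN N L, realKinetic φ X = ENNReal.ofReal (∫ X in cellN N L, gradDot φ φ X) := by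
  have hpt : ∀ X, realKinetic φ X = ENNReal.ofReal (gradDot φ φ X) := fun X => by
    rw [realKinetic_eq_ofReal, gradDot_self_eq_sum_sq]
  simp_rw [hpt]
  exact (ofReal_integral_eq_lintegral_ofReal (integrableOn_cellN (continuous_gradDot hφ hφ) L)
    (ae_of_all _ fun X => gradDot_self_nonneg φ X)).symm

/-! ### The Feynman–Kac ground state: real normalisation and integrated eigen-relation -/

section GroundState

variable {v : ℝ → ℝ≥0∞} {L : ℝ} {Θ₀ : Config N → ℝ}

/-- A continuous periodic torus FK ground state has `∫_cell Θ₀² = 1` (real Bochner form of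
`IsPeriodicGroundStateFK.norm_eq`). [folklore] -/
theorem integral_sq_eq_one_of_fk (hΘ : IsPeriodicGroundStateFK v L Θ₀) (hcont : Continuous Θ₀)
    (hL : 0 < L) : ∫ X in cellN N L, Θ₀ X ^ 2 = 1 := by
  obtain ⟨M, -, hM⟩ := exists_bound_of_continuous_periodic hL hcont hΘ.periodic
  have hsq : Integrable (fun X => Θ₀ X ^ 2) (volume.restrict (cellN N L)) :=
    (memLp_two_cellN_of_bound L hcont.measurable hM).integrable_sq
  have h1 := hΘ.norm_eq
  have h2 : ∫⁻ X in cellN N L, ENNReal.ofReal (Θ₀ X) ^ 2 =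
      ENNReal.ofReal (∫ X in cellN N L, Θ₀ X ^ 2) := by
    rw [ofReal_integral_eq_lintegral_ofReal hsq (ae_of_all _ fun X => sq_nonneg _)]
    exact lintegral_congr fun X => by rw [← ENNReal.ofReal_pow (hΘ.nonneg X)]
  rw [h2] at h1
  have h0 : 0 ≤ ∫ X in cellN N L, Θ₀ X ^ 2 := integral_nonneg fun X => sq_nonneg _
  have := ENNReal.toReal_ofReal h0
  rw [h1, ENNReal.toReal_one] at this
  exact this.symm

/-- The **integrated eigen-relation in real form**: `⟨Θ₀, e^{-tH}Θ₀⟩_cell = e^{-E₀t}` for a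
continuous torus FK ground state, `E₀ = periodicGroundStateEnergy.toReal` (stated as `≥`, the form
consumed by `sqIncrCell_div_eventually_le`). [folklore] -/
theorem exp_le_pairing_of_fk (hΘ : IsPeriodicGroundStateFK v L Θ₀) (hv : Measurable v)
    (hcont : Continuous Θ₀) (hL : 0 < L) (t : ℝ) (ht : 0 < t) :
    Real.exp (-((periodicGroundStateEnergy v N L).toReal * t)) ≤
      ∫ X in cellN N L, Θ₀ X * pfkReal v L t Θ₀ X := by
  have hpt : ∀ X, pfkReal v L t Θ₀ X =
      Real.exp (-((periodicGroundStateEnergy v N L).toReal * t)) * Θ₀ X := by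
    intro X
    rw [pfkReal_eq_toReal_periodicFKSemigroup hv L t hΘ.measurable hΘ.nonneg X, hΘ.eigen t ht.le X,
      ENNReal.toReal_ofReal (mul_nonneg (Real.exp_pos _).le (hΘ.nonneg X))]
  simp_rw [hpt]
  have heq : ∫ X in cellN N L, Θ₀ X * (Real.exp (-((periodicGroundStateEnergy v N L).toReal * t)) *
      Θ₀ X) = Real.exp (-((periodicGroundStateEnergy v N L).toReal * t)) *
        ∫ X in cellN N L, Θ₀ X ^ 2 := by
    rw [← integral_const_mul]
    exact integral_congr_ae (ae_of_all _ fun X => by ring)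
  rw [heq, integral_sq_eq_one_of_fk hΘ hcont hL, mul_one]

/-- **The kinetic integral of every mollification of the ground state is at most
`E₀ - ∫_cell Θ₀² V^per`** (bounded periodised potential): Chung–Zhao's free-form bound
`setLIntegral_cellN_realKinetic_mollify_le` fed by `sqIncrCell_div_eventually_le`, read in `ℝ`.
[folklore] -/
theorem integral_gradDot_mollify_le (hΘ : IsPeriodicGroundStateFK v L Θ₀) (hv : Measurable v)
    (hcont : Continuous Θ₀) (hL : 0 < L) {C : ℝ≥0} (hC : ∀ x, periodizedPotential v L x ≤ C)
    {r : ℝ} (hr : 0 < r) :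
    ∫ X in cellN N L, gradDot (mollify hr Θ₀) (mollify hr Θ₀) X ≤
      (periodicGroundStateEnergy v N L).toReal -
        ∫ X in cellN N L, Θ₀ X ^ 2 * (periodicInteraction v L X).toReal := by
  obtain ⟨M, -, hM⟩ := exists_bound_of_continuous_periodic hL hcont hΘ.periodic
  have hnorm := integral_sq_eq_one_of_fk hΘ hcont hL
  have heig := exp_le_pairing_of_fk hΘ hv hcont hL
  have hP := setIntegral_cellN_sq_mul_periodicInteraction_le hv hL hC hcont hΘ.periodic hΘ.nonneg
    hnorm heig
  refine le_of_forall_gt_imp_ge_of_dense fun K' hK' => ?_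
  have hev := sqIncrCell_div_eventually_le hv hL hC hcont hΘ.periodic hΘ.nonneg hnorm heig hK'
  have h := setLIntegral_cellN_realKinetic_mollify_le hL hr hcont hΘ.periodic hM hev
  rw [setLIntegral_realKinetic_eq_ofReal L (contDiff_mollify hr hcont.locallyIntegrable)] at h
  exact (ENNReal.ofReal_le_ofReal_iff (by linarith)).1 h

/-- The potential energy of the ground state is at most `E₀`: `∫_cell Θ₀² V^per ≤ E₀`. [folklore] -/
theorem integral_sq_mul_interaction_le_of_fk (hΘ : IsPeriodicGroundStateFK v L Θ₀) (hv : Measurable v)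
    (hcont : Continuous Θ₀) (hL : 0 < L) {C : ℝ≥0} (hC : ∀ x, periodizedPotential v L x ≤ C) :
    ∫ X in cellN N L, Θ₀ X ^ 2 * (periodicInteraction v L X).toReal ≤
      (periodicGroundStateEnergy v N L).toReal :=
  setIntegral_cellN_sq_mul_periodicInteraction_le hv hL hC hcont hΘ.periodic hΘ.nonneg
    (integral_sq_eq_one_of_fk hΘ hcont hL) (exp_le_pairing_of_fk hΘ hv hcont hL)

end GroundState

/-! ### The periodised interaction as a bounded measurable real weight -/

/-- For `v^per ≤ C` the real interaction `(∑_{i<j} v^per).toReal` is measurable and bounded by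
`N² C`. [folklore] -/
theorem interaction_toReal_measurable_bdd {v : ℝ → ℝ≥0∞} (hv : Measurable v) (L : ℝ) {C : ℝ≥0}
    (hC : ∀ x, periodizedPotential v L x ≤ C) :
    Measurable (fun X : Config N => (periodicInteraction v L X).toReal) ∧
      ∀ X : Config N, |(periodicInteraction v L X).toReal| ≤ ((N * N : ℕ) : ℝ) * C := by
  refine ⟨(measurable_periodicInteraction hv L).ennreal_toReal, fun X => ?_⟩
  -- adapted from the proof of `periodicGroundStateEnergy_le_ofReal_of_eigen`
  rw [abs_of_nonneg ENNReal.toReal_nonneg]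
  have h1 := periodicInteraction_le_of_bound (C := (C : ℝ≥0∞)) (fun x => hC x) X
  have h2 : ((N * N : ℕ) : ℝ≥0∞) * (C : ℝ≥0∞) ≠ ⊤ :=
    ENNReal.mul_ne_top (ENNReal.natCast_ne_top _) ENNReal.coe_ne_top
  have := ENNReal.toReal_mono h2 h1
  rw [ENNReal.toReal_mul] at this
  simpa using this

end Summit.AtomisticToContinuum.BoseEinsteinCondensation.Theorems.CorrectorClosure.HealingScaleKacInsertion.ResponseDictionary

end
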